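import Summits.BirchSwinnertonDyer.Rank1Residual.O6.X3KatoMemberBoundOfHullReadings
import Literature.NumberTheory.EllipticCurves.IsogenyIdProofs
import HarnessLib

/-!
# O6 / X3: the node `O6.KatoMemberShaBoundOfReducible` (T-X3K; = the shared crux `ReducibleKatoMember` of
# routes `KatoDescentPotSupersingular` (K9) / `KatoDescentTamePotSupersingular` (K8-t′), item
# stmt-BirchSwinnertonDyer-19196) — the three HULL READINGS of part 12, existentially closed over the FREE
# interface predicate, are EXACTLY AS STRONG AS the node: a tightness theorem
# (cell `bsd-potss`, seat `bsd-potss-rkm` generation 2; sibling of `X3KatoMemberBoundOfHullReadings.lean`;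
# theorems only, nothing asserted)

HONEST FRAMING. The crux M = `ReducibleKatoMember` (:= cell `b2b-bsdres`'s typed node
`O6.KatoMemberShaBoundOfReducible`, T-X3K) is NOT closed by this file and BSD is not advanced by it.
The tree proves M from three HYPOTHESIS SCHEMATA — kmc part 12,
`O6.katoMemberShaBoundOfReducible_of_hullReadings` (`Rank1Residual/O6/X3KatoMemberBoundOfHullReadings`):
M1 `KatoHull.MemberRealizable IsHullOf` (Kato's member carries a realised hull datum), M2
`KatoHull.DivisibilityReading IsHullOf` (height-one divisibility for the hull: Kato Thm. 12.5 (3) off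
`(p)`, Wuthrich 2014 Lemma 14 at `(p)`), M3 `KatoHull.CountReading IsHullOf` (the rank-0 member count:
Prop. 14.16 (2) + Lemma T + Kim's local index) — all parametrised by a FREE predicate
`IsHullOf W p D` ("`D : KatoHullDescentDatum p` IS Kato's §14.14 datum of `T_pW`"), which is the
definition item D-O6-2 (`defn-KatoMainConjecture`, BLOCKED 2026-08-26: `𝐇²(T)`, the zeta class and the
hull are not objects of the tree).

THE THEOREM OF THIS FILE. `O6.KatoMemberShaBoundOfReducible.iff_exists_hullReadings`:
  `O6.KatoMemberShaBoundOfReducible ↔ ∃ IsHullOf, MemberRealizable IsHullOf ∧ DivisibilityReading IsHullOf ∧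
  CountReading IsHullOf`.
`⟸` is kmc's theorem. `⟹` (`exists_hullReadings_of`): the interface structure
`KatoHullDescentDatum p` admits a TRIVIAL inhabitant (`exists_trivialHullDatum`: `H = F = Λ`, `j = id`,
`z = y = 1`, `e = 0`, `𝐇² = 0`, `A = Λ_Γ`, `ι = id`, `π = 0`; hull divisibility trivially, `[A : y] = 1`,
`#(𝐇²/X𝐇²) = 1`), and over the TAUTOLOGICAL predicate "the conclusions of M2/M3 hold for `(W, D)`" the
readings M2/M3 hold by definition while M1 is witnessed by the crux's own member `W'` with the trivial
datum.

WHAT IT SAYS (for the tenure planner / tribunal of K9 and K8-t′; the seat's REPAIR-CENSUS entry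
"settle M by citation through the hull readings"): existentially closed over the free predicate, the
three readings carry EXACTLY the content of M and no more. They are therefore NOT a citation-level
input as they stand (entering them as a cite-only support would be entering M itself); they become one
only when `IsHullOf` is PINNED to Kato's objects — `H` to the pinned `𝐇¹_Γ(T_pW)⁰`
(`Kato2004.IwasawaH1Data`, p417943), `A` to `H¹(ℤ[1/p], T_pW)` (`Kato2004.integralH1` at level `0`),
`y = p^e z` to Kato's zeta class THROUGH ITS VALUES (an Euler-system / value-law pin of the kind
`Kato2004.ZetaBody`, at Kato's member), and `𝐇²` to `𝐇²(T_pW)⁰` (degree-2 Iwasawa cohomology or its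
Poitou–Tate description by the Λ-adic fine Selmer dual). The seat's note REALISATION-SPEC v3 (item
evidence) records why pinning `H` and `A` alone does not break the collapse (with `z` free one takes
`z := j(y)`, `e = 0`, `𝐇² :=` the cokernel of `H_Γ → A` with `X = 0`, and the count again reduces to M),
so the value-law pin of the zeta class is the load-bearing missing object.

Contents: `exists_trivialHullDatum` · `exists_hullReadings_of` · `iff_exists_hullReadings` (namespace
`O6.KatoMemberShaBoundOfReducible`; the route-typed restatement `Theorems/…ReducibleKatoMemberReadingsTight`
is a one-line corollary since `ReducibleKatoMember := O6.KatoMemberShaBoundOfReducible`). Pure kernel algebra over the tree's interface; no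
Literature fact is used or minted; no `def`, no `instance`.

References: K. Kato, Astérisque 295 (2004) Thm. 12.4–12.6 (pp. 221–222), 13.14 (p. 234), §14.14
(14.14.1)–(14.14.2), Lemma 14.15, Prop. 14.16 (2) (pp. 243–245) [Kato2004Asterisque]; C. Wuthrich,
Doc. Math. 19 (2014) §3.2, Lemma 11, 12, 14 [Wuthrich2014] — the printed inputs the readings
transcribe; this file proves nothing about them.
-/

set_option autoImplicit false

noncomputable section

open scoped Classical

namespace Summit.BirchSwinnertonDyer.Rank1Residual

open WeierstrassCurve Literature.NumberTheory.EllipticCurves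
  Literature.NumberTheory.EllipticCurves.IwasawaAlgebra Additive

namespace O6.KatoMemberShaBoundOfReducible

/-- **The TRIVIAL hull datum exists.** Over `Λ = ℤ_p⟦X⟧` take `H = F = Λ`, `j = id`, `z = y = 1`,
`e = 0`, `𝐇² = 0`, `A = Λ_Γ`, `ι = id`, `π = 0`: every axiom of the interface `KatoHullDescentDatum`
holds, the hull divisibility holds (`𝐇² = 0`), `𝐇²/X𝐇²` is finite, `[A : y] = 1`, `#(𝐇²/X𝐇²) = 1`.
So the interface by itself constrains nothing. [folklore] -/
theorem exists_trivialHullDatum (p : ℕ) [Fact p.Prime] :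
    ∃ D : KatoHullDescentDatum p,
      D.HullDivisibility ∧ Finite (coinvariants p D.H2) ∧ D.yIndex = 1 ∧ D.h2Card = 1 ∧ D.e = 0 := by
  -- `Λ ∙ 1 = ⊤`, so `Λ/Λ∙1` is trivial
  have hsub1 : Subsingleton (IwasawaAlgebra p ⧸ (IwasawaAlgebra p) ∙ (1 : IwasawaAlgebra p)) := by
    rw [Submodule.Quotient.subsingleton_iff]
    exact Ideal.span_singleton_one
  have hsubT : Subsingleton
      (IwasawaAlgebra p ⧸ (⊤ : Submodule (IwasawaAlgebra p) (IwasawaAlgebra p))) :=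
    Submodule.Quotient.subsingleton_iff.mpr rfl
  -- in `Λ_Γ = Λ/XΛ` the class of `1` generates
  have hspan : (IwasawaAlgebra p) ∙ (Submodule.Quotient.mk (1 : IwasawaAlgebra p) :
      coinvariants p (IwasawaAlgebra p)) = ⊤ := by
    refine Submodule.eq_top_iff'.mpr fun x => ?_
    induction x using Submodule.Quotient.induction_on with
    | H r =>
      refine Submodule.mem_span_singleton.mpr ⟨r, ?_⟩
      rw [← Submodule.Quotient.mk_smul]
      simp
  refine ⟨{ H := IwasawaAlgebra p
            F := IwasawaAlgebra p
            j := LinearMap.id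
            j_injective := fun _ _ h => h
            finite_coker := by rw [LinearMap.range_id]; infer_instance
            z := 1
            z_ne_zero := one_ne_zero
            isTorsion_quotient := fun x => ⟨1, by rw [Subsingleton.elim x 0, smul_zero]⟩
            y := 1
            e := 0
            j_y := by simp
            H2 := Fin 0 → IwasawaAlgebra p
            isTorsion_H2 := fun x => ⟨1, by rw [Subsingleton.elim x 0, smul_zero]⟩
            A := coinvariants p (IwasawaAlgebra p)
            ι := LinearMap.id
            π := 0
            ι_injective := fun _ _ h => h
            π_surjective := fun y => ⟨0, Subsingleton.elim _ _⟩
            exact_ι_π := fun y => ⟨fun _ => ⟨y, rfl⟩, fun _ => Subsingleton.elim _ _⟩ },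
    ?_, ?_, ?_, ?_, rfl⟩
  · -- hull divisibility: `𝐇² = 0` has length `0` everywhere
    intro 𝔮 _
    have h0 : Module.lengthAt (IwasawaAlgebra p) (Fin 0 → IwasawaAlgebra p) 𝔮 = 0 :=
      Module.lengthAt_eq_zero_of_subsingleton (R := IwasawaAlgebra p)
        (M := Fin 0 → IwasawaAlgebra p) 𝔮
    change Module.lengthAt (IwasawaAlgebra p) (Fin 0 → IwasawaAlgebra p) 𝔮 ≤ _
    simp only [h0, _root_.zero_le]
  · -- `𝐇²/X𝐇²` finite
    change Finite ((Fin 0 → IwasawaAlgebra p) ⧸ _)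
    infer_instance
  · -- `[A : y] = 1`
    unfold KatoHullDescentDatum.yIndex
    change Nat.card (coinvariants p (IwasawaAlgebra p) ⧸
      (IwasawaAlgebra p) ∙ (LinearMap.id (Submodule.Quotient.mk (1 : IwasawaAlgebra p)) :
        coinvariants p (IwasawaAlgebra p))) = 1
    rw [LinearMap.id_apply, hspan]
    haveI : Subsingleton (coinvariants p (IwasawaAlgebra p) ⧸
        (⊤ : Submodule (IwasawaAlgebra p) (coinvariants p (IwasawaAlgebra p)))) :=
      Submodule.Quotient.subsingleton_iff.mpr rfl
    exact Nat.card_of_subsingleton 0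
  · -- `#(𝐇²/X𝐇²) = 1`
    unfold KatoHullDescentDatum.h2Card
    change Nat.card ((Fin 0 → IwasawaAlgebra p) ⧸ _) = 1
    exact Nat.card_of_subsingleton 0

/-- **M ⟹ the three readings over SOME interface predicate.** Given the crux, define "`D` is a hull
datum of `W` at `p`" TAUTOLOGICALLY as: the hull divisibility holds for `D`, `𝐇²/X𝐇²` is finite,
`[A : y] ≠ 0`, and — if `L(W,1) ≠ 0` and `Ш(W)` is finite — the member count
`ord_p #Ш + v_p Tam + ord_p [A : y] ≤ ord_p q + e + ord_p #(𝐇²/X𝐇²) + 3 t` holds. Then M2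
(`KatoHull.DivisibilityReading`) and M3 (`KatoHull.CountReading`) hold by definition, and M1
(`KatoHull.MemberRealizable`) is witnessed by the crux's own member `W'` carrying the TRIVIAL datum of
`exists_trivialHullDatum` (by `W` itself when `L(W,1) = 0` or `Ш(W)` is infinite). [folklore] -/
theorem exists_hullReadings_of
    (hK : O6.KatoMemberShaBoundOfReducible) :
    ∃ IsHullOf : (∀ (W : WeierstrassCurve ℚ) [W.IsElliptic] [W.IsGloballyMinimal] (p : ℕ)
        [Fact p.Prime], KatoHullDescentDatum p → Prop),
      KatoHull.MemberRealizable IsHullOf ∧ KatoHull.DivisibilityReading IsHullOf ∧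
        KatoHull.CountReading IsHullOf := by
  refine ⟨fun W _ _ p _ D =>
      D.HullDivisibility ∧ Finite (coinvariants p D.H2) ∧ D.yIndex ≠ 0 ∧
        (W.entireLFunction 1 ≠ 0 → Finite W.sha →
          ∃ q : ℚ, W.entireLFunction 1 / (W.realPeriodRat : ℂ) = (q : ℂ) ∧
            (padicValNat p (Nat.card (AddCommGroup.primaryComponent W.sha p)) : ℤ) +
                padicValNat p W.tamagawaProduct + padicValNat p D.yIndex ≤
              padicValRat p q + D.e + padicValNat p D.h2Card +
                3 * (padicValNat p W.torsionOrder : ℤ)),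
    ?_, fun _W _ _ _p _ _D _ _ _ _ hD => hD.1,
    fun _W _ _ _p _ _D _ _ _ hL hfin hD => ⟨hD.2.1, hD.2.2.1, hD.2.2.2 hL hfin⟩⟩
  -- M1: Kato's member with a realised datum
  intro W _ _ p _ hp hadd hj hred
  obtain ⟨D, hdiv, hfin2, hy, hh2, he⟩ := exists_trivialHullDatum p
  -- the trivial datum realises the tautological predicate at any curve satisfying the member
  -- inequality (or with `L(·,1) = 0`, or with infinite `Ш`)
  have key : ∀ (V : WeierstrassCurve ℚ) [V.IsElliptic] [V.IsGloballyMinimal],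
      (V.entireLFunction 1 ≠ 0 → Finite V.sha →
        ∃ q : ℚ, V.entireLFunction 1 / (V.realPeriodRat : ℂ) = (q : ℂ) ∧
          (padicValNat p (Nat.card (AddCommGroup.primaryComponent V.sha p)) : ℤ) +
              padicValNat p V.tamagawaProduct ≤
            padicValRat p q + 3 * (padicValNat p V.torsionOrder : ℤ)) →
      D.HullDivisibility ∧ Finite (coinvariants p D.H2) ∧ D.yIndex ≠ 0 ∧
        (V.entireLFunction 1 ≠ 0 → Finite V.sha →
          ∃ q : ℚ, V.entireLFunction 1 / (V.realPeriodRat : ℂ) = (q : ℂ) ∧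
            (padicValNat p (Nat.card (AddCommGroup.primaryComponent V.sha p)) : ℤ) +
                padicValNat p V.tamagawaProduct + padicValNat p D.yIndex ≤
              padicValRat p q + D.e + padicValNat p D.h2Card +
                3 * (padicValNat p V.torsionOrder : ℤ)) := by
    intro V _ _ h
    refine ⟨hdiv, hfin2, by rw [hy]; exact one_ne_zero, fun hL hfin => ?_⟩
    obtain ⟨q, hq, hle⟩ := h hL hfin
    refine ⟨q, hq, ?_⟩
    simp only [hy, hh2, he, padicValNat_one_right, Nat.cast_zero, add_zero]
    exact hle
  by_cases hL : W.entireLFunction 1 ≠ 0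
  · by_cases hfin : Finite W.sha
    · obtain ⟨W', hE', hM', hiso, _, q, hq, hle⟩ := hK W p hp hadd.1 hadd.2 hj hred hL hfin
      exact ⟨W', hE', hM', hiso, D, key W' fun _ _ => ⟨q, hq, hle⟩⟩
    · exact ⟨W, inferInstance, inferInstance, isIsogenous_self W, D, key W fun _ h => absurd h hfin⟩
  · exact ⟨W, inferInstance, inferInstance, isIsogenous_self W, D, key W fun h _ => absurd h hL⟩

/-- **TIGHTNESS of the hull-reading road (no-go for the un-pinned closure).** The node
`O6.KatoMemberShaBoundOfReducible` (crux `ReducibleKatoMember`) holds IF AND ONLY IF there is SOME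
interface predicate `IsHullOf` over which the three hull readings M1 `KatoHull.MemberRealizable`, M2
`KatoHull.DivisibilityReading`, M3 `KatoHull.CountReading` (kmc part 12) hold: `⟸` is the tree theorem
`O6.katoMemberShaBoundOfReducible_of_hullReadings`; `⟹` is `exists_hullReadings_of` (tautological
predicate, trivial datum). Consequence: the readings, existentially closed over the FREE
predicate, carry exactly the content of the crux — they can settle the item by citation ONLY once
`IsHullOf` is PINNED to Kato's objects (`𝐇¹_Γ(T_pW)⁰`, `H¹(ℤ[1/p], T_pW)`, the zeta class through its
values, `𝐇²(T_pW)⁰`), which is the definition item D-O6-2. The same statement holds verbatim for the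
route decls `Theses.KatoDescent{,Tame}PotSupersingular.ReducibleKatoMember` (both := this node). [folklore] -/
theorem iff_exists_hullReadings :
    O6.KatoMemberShaBoundOfReducible ↔
      ∃ IsHullOf : (∀ (W : WeierstrassCurve ℚ) [W.IsElliptic] [W.IsGloballyMinimal] (p : ℕ)
          [Fact p.Prime], KatoHullDescentDatum p → Prop),
        KatoHull.MemberRealizable IsHullOf ∧ KatoHull.DivisibilityReading IsHullOf ∧
          KatoHull.CountReading IsHullOf :=
  ⟨exists_hullReadings_of,
    fun ⟨_, hM, hD, hC⟩ => O6.katoMemberShaBoundOfReducible_of_hullReadings hM hD hC⟩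

end O6.KatoMemberShaBoundOfReducible

end Summit.BirchSwinnertonDyer.Rank1Residual

end
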